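import Literature.NumberTheory.Weil1964.AdelicThetaMajorants
import Literature.NumberTheory.Weil1964.AdelicMetaplecticGenerators
import Literature.NumberTheory.Weil1964.ThetaKernelDualPair
import Literature.NumberTheory.Automorphic.AdelicPiSchwartzBruhatDensity
import HarnessLib

/-!
# The theta-side orbit functional `Φ ↦ ∫_{G/Γ} Σ_{ξ ≠ 0} Φ(a_g ξ) dν(g)` of a geometric action on `𝒮(𝔸_F^m)`

Topic `NumberTheory/Weil1965`; namespace `Literature.NumberTheory.Weil1965`.  KERNEL MATHEMATICS ONLY: definitions
with bodies and theorems; no `def … : Prop` record, no `axiom`, no proof hole.  Written for the cell `hodgecm-mathlib`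
(floor-0 line P4, engine E-2, row I-STRUCT-I: the theta side of the Siegel–Weil identity in Weil's convergent range).

THE MATHEMATICS ([Weil1965, n° 41–45 and n° 52]).  Let a locally compact group `G` act LINEARLY on `X_𝔸 = 𝔸_F^m`
(`A : G →* GL(X_𝔸)`, continuous orbit maps), let `Γ ≤ G` be a subgroup whose elements permute the rational points
`X_k = F^m`, and let `ν` be a finite `G`-invariant measure on the compact quotient `G/Γ`.  For a Schwartz–Bruhat
function `Φ` the orbit sums `g ↦ Σ_{ξ ∈ X_k ∖ 0} Φ(A(g) ξ)` converge absolutely, uniformly on compacta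
([Weil1964, Chap. III n° 41, Lemme 5]: one summable majorant on every compact set), are continuous and right
`Γ`-invariant, hence descend to a continuous function on `G/Γ`; its `ν`-integral
`Λ(Φ) := ∫_{G/Γ} Σ_{ξ ≠ 0} Φ(A(g) ξ) dν(g)` is a POSITIVE LINEAR FUNCTIONAL on `𝒮(X_𝔸)` invariant under
`Φ ↦ Φ ∘ A(g₀)` — Weil's theta integral with the origin term removed, as a positive tempered distribution.  By
Weil's Lemme 3 ([Weil1965, Chap. I n° 2 p. 7]; the tree's `RieszRepresentation/PositiveFunctionalExtension` +
`AdelicPiSchwartzBruhatDensity`) it is a positive Radon measure on `X_𝔸`; that packaging is the consumer's.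
* §1 the action read in `GL_m(𝔸_F)`: `actMatrixGL A : G →* GL_m(𝔸_F)` (`A g x = x ᵥ* (actTwistGL A g)`, so
  `Φ ∘ A(g) = twist (actTwistGL A g) Φ`), continuity of `actTwistGL` from continuity of the orbit maps;
* §2 the orbit sums `orbitSum A Φ g := Σ'_{ξ ≠ 0} Φ(A g (ratPt ξ))`: absolute convergence, the uniform majorant on
  compacta, continuity in `g`, additivity ∕ homogeneity in `Φ`, nonnegativity for `Φ ≥ 0`, right `Γ`-invariance
  (`orbitSum_mul_of_mem`) and the left law `orbitSum A (Φ ∘ A g₀) g = orbitSum A Φ (g₀ g)`; the full theta sum is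
  `Φ(0) + orbitSum` (`tsum_eq_apply_zero_add_orbitSum`);
* §3 the descent `orbitSumQuot A Φ : G ⧸ Γ → ℂ`, continuous, and THE FUNCTIONAL
  `orbitFunctional ν A : 𝒮(𝔸_F^m) →ₗ[ℂ] ℂ`, `Φ ↦ ∫ orbitSumQuot A Φ dν`, with `orbitFunctional_comp`
  (invariance under `Φ ↦ Φ ∘ A(g₀)`, `ν` invariant), `orbitFunctional_nonneg` (positivity), and its REAL form
  `orbitFunctionalReal ν A : 𝒮_ℝ(𝔸_F^m) →ₗ[ℝ] ℝ` (positive — the input `hS` of ★ `piSchwartzBruhatReal_sandwich`).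
The dual-pair consumer (`Summits/…/Theorems/H413E2SWThetaSideStructure`) takes `G = U(J_V)(𝔸_F)`,
`A = diagAct ∘ ι_V` (★ `Weil1964/AdelicDoublingGeometricFrame`), `Γ = U(J_V)(F)`.

## References
* [Weil1965] A. Weil, *Sur la formule de Siegel dans la théorie des groupes classiques*, Acta Math. 113 (1965):
  Chap. I n° 2 Lemme 3 p. 7 (positive tempered distributions are measures), Chap. IV n° 41–45 (the measures `μ_i` and
  their invariance), n° 52 (the theta integral unfolded over rational orbits).
* [Weil1964] A. Weil, *Sur certains groupes d'opérateurs unitaires*, Acta Math. 111 (1964), Chap. III n° 41, Lemme 5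
  p. 192 (uniform majorants on compacta).
-/

set_option autoImplicit false

noncomputable section

namespace Literature.NumberTheory.Weil1965

open Literature.NumberTheory.Automorphic Literature.NumberTheory.Weil1964
open NumberField _root_.MeasureTheory
open scoped Matrix Topology

/-! ## §1 The action read in `GL_m(𝔸_F)` -/

section Action

variable (F : Type) [Field F] [NumberField F] {m : ℕ}
variable {G : Type*} [Group G]

local notation "𝔸F" => AdeleRing (𝓞 F) F
local notation "X𝔸" => (Fin m → AdeleRing (𝓞 F) F)

/-- the matrix of `A g`. [folklore] -/
def actMatrix (A : G →* (X𝔸 ≃ₗ[𝔸F] X𝔸)) (g : G) : Matrix (Fin m) (Fin m) 𝔸F :=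
  LinearMap.toMatrix' ((A g : X𝔸 ≃ₗ[𝔸F] X𝔸) : X𝔸 →ₗ[𝔸F] X𝔸)

/-- `actMatrix A g *ᵥ x = A g x` (the action in column coordinates). [cite: Weil1965, n° 45] -/
theorem actMatrix_mulVec (A : G →* (X𝔸 ≃ₗ[𝔸F] X𝔸)) (g : G) (x : X𝔸) : actMatrix F A g *ᵥ x = A g x :=
  LinearMap.toMatrix'_mulVec _ x

/-- `actMatrix` is multiplicative. [folklore] -/
private theorem actMatrix_mul (A : G →* (X𝔸 ≃ₗ[𝔸F] X𝔸)) (g h : G) :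
    actMatrix F A (g * h) = actMatrix F A g * actMatrix F A h := by
  rw [actMatrix, actMatrix, actMatrix, ← LinearMap.toMatrix'_comp, map_mul]
  rfl

/-- `actMatrix A 1 = 1`. [folklore] -/
private theorem actMatrix_one (A : G →* (X𝔸 ≃ₗ[𝔸F] X𝔸)) : actMatrix F A 1 = 1 := by
  rw [actMatrix, map_one]
  exact LinearMap.toMatrix'_id

/-- **the action as a homomorphism `G →* GL_m(𝔸_F)`** (column convention `A g x = actMatrix g *ᵥ x`).
[cite: Weil1965, n° 45] -/
def actMatrixGL (A : G →* (X𝔸 ≃ₗ[𝔸F] X𝔸)) : G →* GL (Fin m) 𝔸F where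
  toFun g := ⟨actMatrix F A g, actMatrix F A g⁻¹,
    by rw [← actMatrix_mul, mul_inv_cancel, actMatrix_one],
    by rw [← actMatrix_mul, inv_mul_cancel, actMatrix_one]⟩
  map_one' := Units.ext (actMatrix_one F A)
  map_mul' g h := Units.ext (actMatrix_mul F A g h)

/-- underlying matrix of `actMatrixGL g`. [cite: Weil1965, n° 45] -/
@[simp] theorem coe_actMatrixGL (A : G →* (X𝔸 ≃ₗ[𝔸F] X𝔸)) (g : G) :
    ((actMatrixGL F A g : GL (Fin m) 𝔸F) : Matrix (Fin m) (Fin m) 𝔸F) = actMatrix F A g := rfl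

/-- **the ROW form `L_g = (actMatrix g)ᵀ = trInv (actMatrixGL g⁻¹)`**: `A g x = x ᵥ* L_g`, so that
`Φ (A g x) = twist F L_g Φ x` (the tree's `twist` is the row-vector convention). [cite: Weil1965, n° 45] -/
def actTwistGL (A : G →* (X𝔸 ≃ₗ[𝔸F] X𝔸)) (g : G) : GL (Fin m) 𝔸F := trInv (actMatrixGL F A g⁻¹)

/-- the matrix of `L_g` is the transpose of `actMatrix g`. [cite: Weil1965, n° 45] -/
theorem coe_actTwistGL (A : G →* (X𝔸 ≃ₗ[𝔸F] X𝔸)) (g : G) :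
    ((actTwistGL F A g : GL (Fin m) 𝔸F) : Matrix (Fin m) (Fin m) 𝔸F) = (actMatrix F A g)ᵀ := by
  rw [actTwistGL, coe_trInv, ← map_inv, inv_inv, coe_actMatrixGL]

/-- **`Φ (A g x) = twist L_g Φ x`**. [cite: Weil1965, n° 45] -/
theorem twist_actTwistGL (A : G →* (X𝔸 ≃ₗ[𝔸F] X𝔸)) (g : G) (Φ : X𝔸 → ℂ) (x : X𝔸) :
    twist F (actTwistGL F A g) Φ x = Φ (A g x) := by
  rw [twist_apply, coe_actTwistGL, Matrix.vecMul_transpose, actMatrix_mulVec]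

variable [TopologicalSpace G] [IsTopologicalGroup G]

/-- **continuity of `g ↦ L_g ∈ GL_m(𝔸_F)`** from continuity of the orbit maps `g ↦ A g x` (entries are orbit
coordinates; the inverse is `L_{g⁻¹}`) — the input of Weil's Lemme 5 on compacta. [cite: Weil1964, Chap. III n° 41, Lemme 5 p. 192] -/
theorem continuous_actTwistGL (A : G →* (X𝔸 ≃ₗ[𝔸F] X𝔸)) (hA : ∀ x : X𝔸, Continuous fun g => A g x) :
    Continuous (actTwistGL F A) := by
  have hmat : ∀ f : G → G, Continuous f → Continuous fun g => (actMatrix F A (f g))ᵀ := by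
    intro f hf
    refine continuous_matrix fun i j => ?_
    simp only [Matrix.transpose_apply, actMatrix, LinearMap.toMatrix'_apply, LinearEquiv.coe_coe]
    exact (continuous_apply j).comp ((hA _).comp hf)
  refine Units.continuous_iff.2 ⟨?_, ?_⟩
  · have h : (Units.val ∘ actTwistGL F A) = fun g => (actMatrix F A g)ᵀ := funext fun g => coe_actTwistGL F A g
    rw [h]
    exact hmat id continuous_id
  · have h : (fun g => (((actTwistGL F A g)⁻¹ : GL (Fin m) 𝔸F) : Matrix (Fin m) (Fin m) 𝔸F)) =
        fun g => (actMatrix F A g⁻¹)ᵀ := by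
      funext g
      rw [actTwistGL, coe_trInv_inv, coe_actMatrixGL]
    rw [h]
    exact hmat (fun g => g⁻¹) continuous_inv

end Action

/-! ## §2 The orbit sums `Σ_{ξ ≠ 0} Φ(A g ξ)` -/

section OrbitSum

variable (F : Type) [Field F] [NumberField F] {m : ℕ}
variable {G : Type*} [Group G]

local notation "𝔸F" => AdeleRing (𝓞 F) F
local notation "X𝔸" => (Fin m → AdeleRing (𝓞 F) F)

/-- the non-zero rational points `X_k ∖ 0`. [folklore] -/
abbrev NonzeroRat (m : ℕ) : Type := ↥({ξ : Fin m → F | ξ ≠ 0} : Set (Fin m → F))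

/-- **the orbit sum** `Σ'_{ξ ∈ F^m ∖ 0} Φ(A(g) ξ)` of a function `Φ` on `𝔸_F^m` along the rational points moved by
`A(g)` (Weil's `Σ_{ξ ∈ X_k, ξ ≠ 0} Φ(ξ g)`). [cite: Weil1965, n° 52] -/
def orbitSum (A : G →* (X𝔸 ≃ₗ[𝔸F] X𝔸)) (Φ : X𝔸 → ℂ) (g : G) : ℂ :=
  ∑' ξ : NonzeroRat F m, Φ (A g (ratPt F (Fin m) (ξ : Fin m → F)))

variable {F}

/-- **absolute convergence** of the orbit sum of a Schwartz–Bruhat function (over all of `F^m`).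
[cite: Weil1964, Chap. III n° 41, Lemme 5 p. 192] -/
theorem summable_norm_apply_ratPt (A : G →* (X𝔸 ≃ₗ[𝔸F] X𝔸)) {Φ : X𝔸 → ℂ} (hΦ : Φ ∈ piSchwartzBruhat F (Fin m))
    (g : G) : Summable fun ξ : Fin m → F => ‖Φ (A g (ratPt F (Fin m) ξ))‖ := by
  have h := summable_norm_ratPt (twist_mem hΦ (actTwistGL F A g))
  exact h.congr fun ξ => by rw [twist_actTwistGL]

/-- absolute convergence over the non-zero points. [cite: Weil1964, Chap. III n° 41, Lemme 5 p. 192] -/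
theorem summable_norm_orbitSum_term (A : G →* (X𝔸 ≃ₗ[𝔸F] X𝔸)) {Φ : X𝔸 → ℂ}
    (hΦ : Φ ∈ piSchwartzBruhat F (Fin m)) (g : G) :
    Summable fun ξ : NonzeroRat F m => ‖Φ (A g (ratPt F (Fin m) (ξ : Fin m → F)))‖ :=
  (summable_norm_apply_ratPt A hΦ g).subtype _

/-- convergence over the non-zero points. [cite: Weil1964, Chap. III n° 41, Lemme 5 p. 192] -/
theorem summable_orbitSum_term (A : G →* (X𝔸 ≃ₗ[𝔸F] X𝔸)) {Φ : X𝔸 → ℂ}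
    (hΦ : Φ ∈ piSchwartzBruhat F (Fin m)) (g : G) :
    Summable fun ξ : NonzeroRat F m => Φ (A g (ratPt F (Fin m) (ξ : Fin m → F))) :=
  (summable_norm_orbitSum_term A hΦ g).of_norm

/-- **the theta sum splits off its origin term**: `Σ'_{ξ ∈ F^m} Φ(A g ξ) = Φ(0) + orbitSum A Φ g` (`A g 0 = 0`).
[cite: Weil1965, n° 52] -/
theorem tsum_eq_apply_zero_add_orbitSum (A : G →* (X𝔸 ≃ₗ[𝔸F] X𝔸)) {Φ : X𝔸 → ℂ}
    (hΦ : Φ ∈ piSchwartzBruhat F (Fin m)) (g : G) :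
    ∑' ξ : Fin m → F, Φ (A g (ratPt F (Fin m) ξ)) = Φ 0 + orbitSum F A Φ g := by
  classical
  have hs : Summable fun ξ : Fin m → F => Φ (A g (ratPt F (Fin m) ξ)) := (summable_norm_apply_ratPt A hΦ g).of_norm
  rw [hs.tsum_eq_add_tsum_ite 0, ratPt_zero, map_zero, orbitSum,
    tsum_subtype ({ξ : Fin m → F | ξ ≠ 0} : Set (Fin m → F)) fun ξ => Φ (A g (ratPt F (Fin m) ξ))]
  congr 1
  exact tsum_congr fun ξ => by
    by_cases hξ : ξ = 0
    · rw [if_pos hξ, Set.indicator_of_notMem (by simpa using hξ)]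
    · rw [if_neg hξ, Set.indicator_of_mem (by simpa using hξ)]

/-- `orbitSum` is additive in `Φ`. [cite: Weil1965, n° 52] -/
theorem orbitSum_add (A : G →* (X𝔸 ≃ₗ[𝔸F] X𝔸)) {Φ Ψ : X𝔸 → ℂ} (hΦ : Φ ∈ piSchwartzBruhat F (Fin m))
    (hΨ : Ψ ∈ piSchwartzBruhat F (Fin m)) (g : G) :
    orbitSum F A (Φ + Ψ) g = orbitSum F A Φ g + orbitSum F A Ψ g := by
  simp only [orbitSum, Pi.add_apply]
  exact (summable_orbitSum_term A hΦ g).tsum_add (summable_orbitSum_term A hΨ g)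

/-- `orbitSum` is homogeneous in `Φ`. [cite: Weil1965, n° 52] -/
theorem orbitSum_smul (A : G →* (X𝔸 ≃ₗ[𝔸F] X𝔸)) (a : ℂ) (Φ : X𝔸 → ℂ) (g : G) :
    orbitSum F A (a • Φ) g = a * orbitSum F A Φ g := by
  simp only [orbitSum, Pi.smul_apply, smul_eq_mul]
  exact tsum_mul_left

/-- **positivity**: for a pointwise non-negative real-valued `Φ` (read in `ℂ`) the orbit sum is a non-negative real.
[cite: Weil1965, Chap. I n° 2, Lemme 3, p. 7] -/
theorem orbitSum_ofReal_nonneg (A : G →* (X𝔸 ≃ₗ[𝔸F] X𝔸)) {Ψ : X𝔸 → ℝ} (hΨ : ∀ x, 0 ≤ Ψ x) (g : G) :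
    0 ≤ (orbitSum F A (fun x => (Ψ x : ℂ)) g).re ∧ (orbitSum F A (fun x => (Ψ x : ℂ)) g).im = 0 := by
  rw [orbitSum, ← Complex.ofReal_tsum, Complex.ofReal_re, Complex.ofReal_im]
  exact ⟨tsum_nonneg fun ξ => hΨ _, rfl⟩

/-- the orbit sum of a real function is real: `orbitSum (Ψ : ℂ) = ((Σ' Ψ …) : ℂ)`. [cite: Weil1965, Chap. I n° 2, Lemme 3, p. 7] -/
theorem orbitSum_ofReal (A : G →* (X𝔸 ≃ₗ[𝔸F] X𝔸)) (Ψ : X𝔸 → ℝ) (g : G) :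
    orbitSum F A (fun x => (Ψ x : ℂ)) g = ((∑' ξ : NonzeroRat F m, Ψ (A g (ratPt F (Fin m) (ξ : Fin m → F))) : ℝ) : ℂ) := by
  rw [orbitSum, ← Complex.ofReal_tsum]

/-- **the left law**: `orbitSum A (Φ ∘ A g₀) g = orbitSum A Φ (g₀ g)`. [cite: Weil1965, n° 45] -/
theorem orbitSum_comp (A : G →* (X𝔸 ≃ₗ[𝔸F] X𝔸)) (Φ : X𝔸 → ℂ) (g₀ g : G) :
    orbitSum F A (fun x => Φ (A g₀ x)) g = orbitSum F A Φ (g₀ * g) := by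
  simp only [orbitSum, map_mul, LinearEquiv.mul_apply]

/-- the bijection of the non-zero rational points induced by an element permuting the rational points. [folklore] -/
private theorem exists_equiv_of_ratPt (A : G →* (X𝔸 ≃ₗ[𝔸F] X𝔸)) {γ : G}
    (hγ : ∀ ξ : Fin m → F, ∃ ξ' : Fin m → F, A γ (ratPt F (Fin m) ξ) = ratPt F (Fin m) ξ')
    (hγ' : ∀ ξ : Fin m → F, ∃ ξ' : Fin m → F, A γ⁻¹ (ratPt F (Fin m) ξ) = ratPt F (Fin m) ξ') :
    ∃ σ : NonzeroRat F m ≃ NonzeroRat F m,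
      ∀ ξ : NonzeroRat F m, A γ (ratPt F (Fin m) (ξ : Fin m → F)) = ratPt F (Fin m) (σ ξ : Fin m → F) := by
  classical
  choose f hf using hγ
  choose f' hf' using hγ'
  -- `f` and `f'` are mutually inverse on all of `F^m`
  have hff' : ∀ ξ, f' (f ξ) = ξ := fun ξ => by
    apply ratPt_injective (F := F) (ι := Fin m)
    rw [← hf', ← hf, ← LinearEquiv.mul_apply, ← map_mul, inv_mul_cancel, map_one]
    rfl
  have hf'f : ∀ ξ, f (f' ξ) = ξ := fun ξ => by
    apply ratPt_injective (F := F) (ι := Fin m)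
    rw [← hf, ← hf', ← LinearEquiv.mul_apply, ← map_mul, mul_inv_cancel, map_one]
    rfl
  have hne : ∀ ξ : Fin m → F, ξ ≠ 0 → f ξ ≠ 0 := fun ξ hξ h0 => by
    apply hξ
    apply ratPt_injective (F := F) (ι := Fin m)
    have h1 := hf ξ
    rw [h0, ratPt_zero, ← (A γ).map_zero] at h1
    rw [ratPt_zero]
    exact (A γ).injective h1
  have hne' : ∀ ξ : Fin m → F, ξ ≠ 0 → f' ξ ≠ 0 := fun ξ hξ h0 => by
    apply hξ
    rw [← hf'f ξ, h0]
    have h1 := hff' 0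
    have h2 : f 0 = 0 := by
      apply ratPt_injective (F := F) (ι := Fin m)
      rw [← hf 0, ratPt_zero, map_zero]
    exact h2
  refine ⟨⟨fun ξ => ⟨f ξ, hne ξ ξ.2⟩, fun ξ => ⟨f' ξ, hne' ξ ξ.2⟩, fun ξ => Subtype.ext (hff' ξ),
    fun ξ => Subtype.ext (hf'f ξ)⟩, fun ξ => hf ξ⟩

/-- **right `Γ`-invariance**: if `A γ` permutes the rational points then `orbitSum A Φ (g γ) = orbitSum A Φ g`
(reindex the non-zero rational points). [cite: Weil1965, n° 52] -/
theorem orbitSum_mul_of_ratPt (A : G →* (X𝔸 ≃ₗ[𝔸F] X𝔸)) (Φ : X𝔸 → ℂ) (g : G) {γ : G}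
    (hγ : ∀ ξ : Fin m → F, ∃ ξ' : Fin m → F, A γ (ratPt F (Fin m) ξ) = ratPt F (Fin m) ξ')
    (hγ' : ∀ ξ : Fin m → F, ∃ ξ' : Fin m → F, A γ⁻¹ (ratPt F (Fin m) ξ) = ratPt F (Fin m) ξ') :
    orbitSum F A Φ (g * γ) = orbitSum F A Φ g := by
  obtain ⟨σ, hσ⟩ := exists_equiv_of_ratPt A hγ hγ'
  simp only [orbitSum, map_mul, LinearEquiv.mul_apply, hσ]
  exact σ.tsum_eq fun ξ : NonzeroRat F m => Φ (A g (ratPt F (Fin m) (ξ : Fin m → F)))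

variable [TopologicalSpace G] [IsTopologicalGroup G]

/-- **ONE summable majorant on every compact set** (Weil's Lemme 5 transported along the continuous `g ↦ L_g`).
[cite: Weil1964, Chap. III n° 41, Lemme 5 p. 192] -/
theorem exists_summable_majorant_of_isCompact (A : G →* (X𝔸 ≃ₗ[𝔸F] X𝔸)) (hA : ∀ x : X𝔸, Continuous fun g => A g x)
    {Φ : X𝔸 → ℂ} (hΦ : Φ ∈ piSchwartzBruhat F (Fin m)) {C : Set G} (hC : IsCompact C) :
    ∃ u : (Fin m → F) → ℝ, Summable u ∧ ∀ (ξ : Fin m → F), ∀ g ∈ C, ‖Φ (A g (ratPt F (Fin m) ξ))‖ ≤ u ξ := by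
  obtain ⟨u, hu, hle⟩ := exists_summable_majorant_twist_of_isCompact F hΦ
    (hC.image (continuous_actTwistGL F A hA))
  exact ⟨u, hu, fun ξ g hg => by
    rw [← twist_actTwistGL F A g Φ (ratPt F (Fin m) ξ)]
    exact hle ξ _ (Set.mem_image_of_mem _ hg)⟩

/-- **continuity of the orbit sum** in `g` (M-test on compacta). [cite: Weil1964, Chap. III n° 41 Thm 6 p. 193] -/
theorem continuous_orbitSum [LocallyCompactSpace G] (A : G →* (X𝔸 ≃ₗ[𝔸F] X𝔸))
    (hA : ∀ x : X𝔸, Continuous fun g => A g x) {Φ : X𝔸 → ℂ} (hΦ : Φ ∈ piSchwartzBruhat F (Fin m)) :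
    Continuous (orbitSum F A Φ) := by
  have hc : Continuous Φ := continuous_of_mem_piSchwartzBruhat hΦ
  refine continuous_tsum_of_dominated_on_compacts (fun ξ => hc.comp (hA _)) fun C hC => ?_
  obtain ⟨u, hu, hle⟩ := exists_summable_majorant_of_isCompact A hA hΦ hC
  exact ⟨fun ξ : NonzeroRat F m => u ξ, hu.subtype _, fun ξ g hg => hle ξ g hg⟩

end OrbitSum

/-! ## §3 Descent to `G ⧸ Γ` and the functional `Φ ↦ ∫_{G/Γ} Σ_{ξ ≠ 0} Φ(A g ξ) dν` -/

section Descent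

variable (F : Type) [Field F] [NumberField F] {m : ℕ}
variable {G : Type*} [Group G] (Γ : Subgroup G)
variable (A : G →* ((Fin m → AdeleRing (𝓞 F) F) ≃ₗ[AdeleRing (𝓞 F) F] (Fin m → AdeleRing (𝓞 F) F)))
variable (hΓ : ∀ γ ∈ Γ, ∀ ξ : Fin m → F, ∃ ξ' : Fin m → F, A γ (ratPt F (Fin m) ξ) = ratPt F (Fin m) ξ')

local notation "𝔸F" => AdeleRing (𝓞 F) F
local notation "X𝔸" => (Fin m → AdeleRing (𝓞 F) F)

include hΓ in
/-- right `Γ`-invariance from the hypothesis on `Γ`. [cite: Weil1965, n° 52] -/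
theorem orbitSum_mul_of_mem (Φ : X𝔸 → ℂ) (g : G) {γ : G} (hγ : γ ∈ Γ) : orbitSum F A Φ (g * γ) = orbitSum F A Φ g :=
  orbitSum_mul_of_ratPt A Φ g (hΓ γ hγ) (hΓ γ⁻¹ (Γ.inv_mem hγ))

/-- **the descended orbit sum** on `G ⧸ Γ`. [cite: Weil1965, n° 52] -/
def orbitSumQuot (Φ : X𝔸 → ℂ) : G ⧸ Γ → ℂ :=
  descend Γ (orbitSum F A Φ) fun g _ hγ => orbitSum_mul_of_mem F Γ A hΓ Φ g hγ

/-- on representatives. [cite: Weil1965, n° 52] -/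
@[simp] theorem orbitSumQuot_mk (Φ : X𝔸 → ℂ) (g : G) :
    orbitSumQuot F Γ A hΓ Φ (QuotientGroup.mk g) = orbitSum F A Φ g := rfl

/-- the descended orbit sum on `Quotient.out` representatives. [cite: Weil1965, n° 52] -/
theorem orbitSum_out (Φ : X𝔸 → ℂ) (q : G ⧸ Γ) : orbitSum F A Φ (Quotient.out q) = orbitSumQuot F Γ A hΓ Φ q := by
  conv_rhs => rw [← QuotientGroup.out_eq' q]
  rfl

end Descent

section Functional

variable (F : Type) [Field F] [NumberField F] {m : ℕ}
variable {G : Type*} [Group G] [TopologicalSpace G] [IsTopologicalGroup G] [LocallyCompactSpace G]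
variable (Γ : Subgroup G) [CompactSpace (G ⧸ Γ)] [MeasurableSpace (G ⧸ Γ)] [BorelSpace (G ⧸ Γ)]
variable (ν : Measure (G ⧸ Γ)) [IsFiniteMeasure ν]
variable (A : G →* ((Fin m → AdeleRing (𝓞 F) F) ≃ₗ[AdeleRing (𝓞 F) F] (Fin m → AdeleRing (𝓞 F) F)))
variable (hA : ∀ x : Fin m → AdeleRing (𝓞 F) F, Continuous fun g => A g x)
variable (hΓ : ∀ γ ∈ Γ, ∀ ξ : Fin m → F, ∃ ξ' : Fin m → F, A γ (ratPt F (Fin m) ξ) = ratPt F (Fin m) ξ')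

local notation "𝔸F" => AdeleRing (𝓞 F) F
local notation "X𝔸" => (Fin m → AdeleRing (𝓞 F) F)

include hA in
omit [CompactSpace (G ⧸ Γ)] [MeasurableSpace (G ⧸ Γ)] [BorelSpace (G ⧸ Γ)] in
/-- **continuity downstairs**. [cite: Weil1964, Chap. III n° 41 Thm 6 p. 193] -/
theorem continuous_orbitSumQuot {Φ : X𝔸 → ℂ} (hΦ : Φ ∈ piSchwartzBruhat F (Fin m)) :
    Continuous (orbitSumQuot F Γ A hΓ Φ) := by
  rw [QuotientGroup.isOpenQuotientMap_mk.isQuotientMap.continuous_iff]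
  exact continuous_orbitSum A hA hΦ

include hA in
/-- integrability downstairs (continuous on a compact space, finite measure). [cite: Weil1965, n° 52] -/
theorem integrable_orbitSumQuot {Φ : X𝔸 → ℂ} (hΦ : Φ ∈ piSchwartzBruhat F (Fin m)) :
    Integrable (orbitSumQuot F Γ A hΓ Φ) ν :=
  (continuous_orbitSumQuot F Γ A hA hΓ hΦ).integrable_of_hasCompactSupport
    (HasCompactSupport.of_compactSpace _)

/-- **THE THETA-SIDE ORBIT FUNCTIONAL** `Λ(Φ) := ∫_{G/Γ} Σ'_{ξ ≠ 0} Φ(A(g) ξ) dν(g)` on `𝒮(𝔸_F^m)` — Weil's theta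
integral with the origin term removed. [cite: Weil1965, n° 52] -/
def orbitFunctional : piSchwartzBruhat F (Fin m) →ₗ[ℂ] ℂ where
  toFun Φ := ∫ q, orbitSumQuot F Γ A hΓ (Φ : X𝔸 → ℂ) q ∂ν
  map_add' Φ Ψ := by
    have h : orbitSumQuot F Γ A hΓ ((Φ + Ψ : piSchwartzBruhat F (Fin m)) : X𝔸 → ℂ) =
        fun q => orbitSumQuot F Γ A hΓ (Φ : X𝔸 → ℂ) q + orbitSumQuot F Γ A hΓ (Ψ : X𝔸 → ℂ) q := by
      funext q
      induction q using QuotientGroup.induction_on with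
      | H g => exact orbitSum_add A Φ.2 Ψ.2 g
    rw [h]
    exact integral_add (integrable_orbitSumQuot F Γ ν A hA hΓ Φ.2) (integrable_orbitSumQuot F Γ ν A hA hΓ Ψ.2)
  map_smul' a Φ := by
    have h : orbitSumQuot F Γ A hΓ ((a • Φ : piSchwartzBruhat F (Fin m)) : X𝔸 → ℂ) =
        fun q => a * orbitSumQuot F Γ A hΓ (Φ : X𝔸 → ℂ) q := by
      funext q
      induction q using QuotientGroup.induction_on with
      | H g => exact orbitSum_smul A a (Φ : X𝔸 → ℂ) g
    rw [h, RingHom.id_apply, smul_eq_mul]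
    exact integral_const_mul a _

/-- unfolding. [cite: Weil1965, n° 52] -/
theorem orbitFunctional_apply (Φ : piSchwartzBruhat F (Fin m)) :
    orbitFunctional F Γ ν A hA hΓ Φ = ∫ q, orbitSumQuot F Γ A hΓ (Φ : X𝔸 → ℂ) q ∂ν := rfl

/-- the same with the integrand on representatives `Quotient.out`. [cite: Weil1965, n° 52] -/
theorem orbitFunctional_apply_out (Φ : piSchwartzBruhat F (Fin m)) :
    orbitFunctional F Γ ν A hA hΓ Φ = ∫ q, orbitSum F A (Φ : X𝔸 → ℂ) (Quotient.out q) ∂ν := by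
  rw [orbitFunctional_apply]
  exact integral_congr_ae (Filter.Eventually.of_forall fun q => (orbitSum_out F Γ A hΓ _ q).symm)

/-- **INVARIANCE** under `Φ ↦ Φ ∘ A(g₀)` for a `G`-invariant `ν`: the orbit functional does not see the action.
[cite: Weil1965, n° 45] -/
theorem orbitFunctional_comp [SMulInvariantMeasure G (G ⧸ Γ) ν] (g₀ : G) (Φ Φ' : piSchwartzBruhat F (Fin m))
    (hΦ' : ∀ x, (Φ' : X𝔸 → ℂ) x = (Φ : X𝔸 → ℂ) (A g₀ x)) :
    orbitFunctional F Γ ν A hA hΓ Φ' = orbitFunctional F Γ ν A hA hΓ Φ := by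
  have h1 : (Φ' : X𝔸 → ℂ) = fun x => (Φ : X𝔸 → ℂ) (A g₀ x) := funext hΦ'
  have h2 : orbitSumQuot F Γ A hΓ (Φ' : X𝔸 → ℂ) = fun q => orbitSumQuot F Γ A hΓ (Φ : X𝔸 → ℂ) (g₀ • q) := by
    funext q
    induction q using QuotientGroup.induction_on with
    | H g => rw [MulAction.Quotient.smul_mk, smul_eq_mul, orbitSumQuot_mk, orbitSumQuot_mk, h1, orbitSum_comp]
  rw [orbitFunctional_apply, orbitFunctional_apply, h2]
  exact integral_smul_eq_self (μ := ν) (orbitSumQuot F Γ A hΓ (Φ : X𝔸 → ℂ))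

/-- **POSITIVITY**: on a pointwise non-negative real Schwartz–Bruhat function (read in `ℂ`) the functional is a
non-negative real. [cite: Weil1965, Chap. I n° 2, Lemme 3, p. 7] -/
theorem orbitFunctional_nonneg (Φ : piSchwartzBruhat F (Fin m)) {Ψ : X𝔸 → ℝ} (hΨ : ∀ x, 0 ≤ Ψ x)
    (hΦΨ : ∀ x, (Φ : X𝔸 → ℂ) x = (Ψ x : ℂ)) :
    0 ≤ (orbitFunctional F Γ ν A hA hΓ Φ).re ∧ (orbitFunctional F Γ ν A hA hΓ Φ).im = 0 := by
  have h1 : (Φ : X𝔸 → ℂ) = fun x => (Ψ x : ℂ) := funext hΦΨ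
  -- the integrand is the real function `q ↦ Σ' Ψ(A q.out ξ)` cast to `ℂ`
  set f : G ⧸ Γ → ℝ := fun q => ∑' ξ : NonzeroRat F m, Ψ (A (Quotient.out q) (ratPt F (Fin m) (ξ : Fin m → F)))
  have h2 : ∀ q : G ⧸ Γ, orbitSum F A (Φ : X𝔸 → ℂ) (Quotient.out q) = ((f q : ℝ) : ℂ) := fun q => by
    rw [h1]
    exact orbitSum_ofReal A Ψ _
  rw [orbitFunctional_apply_out, integral_congr_ae (Filter.Eventually.of_forall h2), integral_complex_ofReal,
    Complex.ofReal_re, Complex.ofReal_im]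
  exact ⟨integral_nonneg fun q => tsum_nonneg fun ξ => hΨ _, rfl⟩

end Functional

/-! ## §4 The real form: a POSITIVE linear functional on `𝒮_ℝ(𝔸_F^m)` (input of Weil's Lemme 3 ∕ Riesz) -/

section Real

variable (F : Type) [Field F] [NumberField F] {m : ℕ}
variable {G : Type*} [Group G] [TopologicalSpace G] [IsTopologicalGroup G] [LocallyCompactSpace G]
variable (Γ : Subgroup G) [CompactSpace (G ⧸ Γ)] [MeasurableSpace (G ⧸ Γ)] [BorelSpace (G ⧸ Γ)]
variable (ν : Measure (G ⧸ Γ)) [IsFiniteMeasure ν]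
variable (A : G →* ((Fin m → AdeleRing (𝓞 F) F) ≃ₗ[AdeleRing (𝓞 F) F] (Fin m → AdeleRing (𝓞 F) F)))
variable (hA : ∀ x : Fin m → AdeleRing (𝓞 F) F, Continuous fun g => A g x)
variable (hΓ : ∀ γ ∈ Γ, ∀ ξ : Fin m → F, ∃ ξ' : Fin m → F, A γ (ratPt F (Fin m) ξ) = ratPt F (Fin m) ξ')

local notation "𝔸F" => AdeleRing (𝓞 F) F
local notation "X𝔸" => (Fin m → AdeleRing (𝓞 F) F)

/-- a real Schwartz–Bruhat function read in `ℂ` (★ `piSchwartzBruhatReal`). [cite: Weil1965, Chap. I n° 2, Lemme 3, p. 7] -/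
def ofRealSB (Ψ : piSchwartzBruhatReal F (Fin m)) : piSchwartzBruhat F (Fin m) :=
  ⟨fun x => ((Ψ : X𝔸 → ℝ) x : ℂ), Ψ.2⟩

/-- unfolding of `ofRealSB`. [cite: Weil1965, Chap. I n° 2, Lemme 3, p. 7] -/
@[simp] theorem coe_ofRealSB (Ψ : piSchwartzBruhatReal F (Fin m)) (x : X𝔸) :
    (ofRealSB F Ψ : X𝔸 → ℂ) x = ((Ψ : X𝔸 → ℝ) x : ℂ) := rfl

/-- **THE REAL ORBIT FUNCTIONAL** `𝒮_ℝ(𝔸_F^m) →ₗ[ℝ] ℝ`, `Ψ ↦ ∫_{G/Γ} Σ'_{ξ ≠ 0} Ψ(A(g) ξ) dν(g)` — the real part of the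
complex one on `Ψ` read in `ℂ` (which is real, `orbitFunctional_nonneg`). [cite: Weil1965, Chap. I n° 2, Lemme 3, p. 7] -/
def orbitFunctionalReal : piSchwartzBruhatReal F (Fin m) →ₗ[ℝ] ℝ where
  toFun Ψ := (orbitFunctional F Γ ν A hA hΓ (ofRealSB F Ψ)).re
  map_add' Ψ₁ Ψ₂ := by
    have h : ofRealSB F (Ψ₁ + Ψ₂) = ofRealSB F Ψ₁ + ofRealSB F Ψ₂ := by
      apply Subtype.ext
      funext x
      simp only [coe_ofRealSB, Submodule.coe_add, Pi.add_apply, Complex.ofReal_add]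
    rw [h, map_add, Complex.add_re]
  map_smul' a Ψ := by
    have h : ofRealSB F (a • Ψ) = (a : ℂ) • ofRealSB F Ψ := by
      apply Subtype.ext
      funext x
      simp only [coe_ofRealSB, Submodule.coe_smul, Pi.smul_apply, smul_eq_mul, Complex.ofReal_mul]
    rw [h, map_smul, smul_eq_mul, Complex.re_ofReal_mul, RingHom.id_apply, smul_eq_mul]

/-- unfolding. [cite: Weil1965, Chap. I n° 2, Lemme 3, p. 7] -/
theorem orbitFunctionalReal_apply (Ψ : piSchwartzBruhatReal F (Fin m)) :
    orbitFunctionalReal F Γ ν A hA hΓ Ψ = (orbitFunctional F Γ ν A hA hΓ (ofRealSB F Ψ)).re := rfl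

/-- the complex functional of a real test function is the real one: `Λ(Ψ) = Λ_ℝ(Ψ)` in `ℂ`.
[cite: Weil1965, Chap. I n° 2, Lemme 3, p. 7] -/
theorem orbitFunctional_ofRealSB (Ψ : piSchwartzBruhatReal F (Fin m)) :
    orbitFunctional F Γ ν A hA hΓ (ofRealSB F Ψ) = (orbitFunctionalReal F Γ ν A hA hΓ Ψ : ℂ) := by
  -- write `Ψ = Ψ⁺ − Ψ⁻`? no: directly, the imaginary part vanishes for ANY real `Ψ` (split `Ψ = max Ψ 0 − max (−Ψ) 0` is
  -- not needed: `orbitSum` of a real function is real, `orbitSum_ofReal`)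
  apply Complex.ext
  · rw [orbitFunctionalReal_apply, Complex.ofReal_re]
  · rw [Complex.ofReal_im]
    set f : G ⧸ Γ → ℝ := fun q => ∑' ξ : NonzeroRat F m, (Ψ : X𝔸 → ℝ) (A (Quotient.out q) (ratPt F (Fin m) (ξ : Fin m → F)))
    have h2 : ∀ q : G ⧸ Γ, orbitSum F A (ofRealSB F Ψ : X𝔸 → ℂ) (Quotient.out q) = ((f q : ℝ) : ℂ) := fun q =>
      orbitSum_ofReal A (Ψ : X𝔸 → ℝ) _
    rw [orbitFunctional_apply_out, integral_congr_ae (Filter.Eventually.of_forall h2), integral_complex_ofReal,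
      Complex.ofReal_im]

/-- **POSITIVITY of the real orbit functional** — hypothesis `hS` of ★ `piSchwartzBruhatReal_sandwich` ∕
★ `RieszRepresentation.sandwichMeasure`: a positive tempered distribution. [cite: Weil1965, Chap. I n° 2, Lemme 3, p. 7] -/
theorem orbitFunctionalReal_nonneg (Ψ : piSchwartzBruhatReal F (Fin m)) (hΨ : 0 ≤ (Ψ : X𝔸 → ℝ)) :
    0 ≤ orbitFunctionalReal F Γ ν A hA hΓ Ψ :=
  (orbitFunctional_nonneg F Γ ν A hA hΓ (ofRealSB F Ψ) (fun x => hΨ x) (fun _ => rfl)).1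

/-- **INVARIANCE of the real orbit functional** under `Ψ ↦ Ψ ∘ A(g₀)` (`ν` invariant).
[cite: Weil1965, n° 45] -/
theorem orbitFunctionalReal_comp [SMulInvariantMeasure G (G ⧸ Γ) ν] (g₀ : G) (Ψ Ψ' : piSchwartzBruhatReal F (Fin m))
    (hΨ' : ∀ x, (Ψ' : X𝔸 → ℝ) x = (Ψ : X𝔸 → ℝ) (A g₀ x)) :
    orbitFunctionalReal F Γ ν A hA hΓ Ψ' = orbitFunctionalReal F Γ ν A hA hΓ Ψ := by
  rw [orbitFunctionalReal_apply, orbitFunctionalReal_apply,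
    orbitFunctional_comp F Γ ν A hA hΓ g₀ (ofRealSB F Ψ) (ofRealSB F Ψ') (fun x => by rw [coe_ofRealSB, coe_ofRealSB, hΨ'])]

end Real

end Literature.NumberTheory.Weil1965
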